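import Summits.QuantumFields.BalabanUV.T4Continuum.Support.VariationalColourOneStep
import Summits.QuantumFields.BalabanUV.T4Continuum.Support.VariationalColourScalarPair
import Summits.QuantumFields.BalabanUV.T4Continuum.Support.VariationalCovariantOneStepPhys

/-!
# T⁴ programme, spine node NE2 (U1a), lane P2 — SUPPLIER ITEM (O8) «V-COL-ONE», PART 3: PHYSICAL UNITS — the one-step END in the colour
# letters and its `blockSpin` reading (the colour re-run of `VariationalCovariantOneStepPhys` (leaf-01-g2, p213284))

NE2 formalisation swarm `b2b-balaban-t4-ne2-formalise-*`, leaf prover 02 (gen 4); P2 skeleton `t4/skeletons/NE2-t4-ne2-p2.md` v0.10 §2.E row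
V-COL, member ONE⁺, part 3, in the colour letters `Scv ∕ Sfv ∕ qWv ∕ qVv ∕ Qkv ∕ Q1v` of `VariationalColourScalarPair` (this seat) + §1 the
regularity functional `rhov n M Rc f = n⁴∕n^d·hessv` (the E-valued twin of `VariationalCovariantInterpolant.rho`).
§2 **`Sfv_interpv_le`**: `Sfv(Λ′) ≤ ( √( Scv λ + (d∕4 + 1∕2)·(L∕n²)·rhov λ ) + √(2d(1+d²))·(n·L·m)·√(qWv λ) )²` (from part 2's lattice END by the
rescaling `VariationalCovariantOneStepPhys.scale_sq_sqrt_add` BY NAME), the `blockSpin` reading **`blockSpin_Q1v_le`** (`T_{Q₁} Sfv (λ) ≤ …`,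
`VariationalTransfer.blockSpin` is type-generic), the `∃`-form `exists_oneStep_colour`, and the transport-FLAT purely additive form
**`blockSpin_Q1v_le_flat`** (`m = 0`: `≤ Scv λ + (d∕4 + 1∕2)·(L∕n²)·rhov λ + 0·qWv λ` — the shape of the capstone binder `hONE` with
`ε₁ = (d∕4 + 1∕2)·L·n⁻²`, `ε₂ = 0`).  Data: unitary site operators `T′`, unitary coarse bond operators `Rc`, fine bond operators `R′`, the two FRAME
defects `≤ m` (part 1).  SAME constants as the scalar leaf.

HONEST FRAMING (T4-DAG p. 1).  Model level (operators DATA; no identification with Bałaban's `U(Γ)`, `Ū`, `U′` — c5); [folklore] rescaling;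
nothing printed is a hypothesis (the one `[cite:]` is the SHAPE locator inherited from the scalar `Sc`); no `def … : Prop`; no `sorry`; axioms
standard.  ONE block step — no tower (N-ne2p2g11-2 ∕ G-ne2leaf04g2-1 apply to any colour tower).  NE2 NOT proved; spine PROVED 0∕9; rung (B)+1
finite T⁴ — NOT infinite volume, NOT a mass gap, NOT Clay.  HONEST DEPENDENCY (cell, verbatim): continuum YM on T⁴ ⇐ BetaPertH ∧ nine spine
estimates (0/9 proved); BetaPertH ⇐ (D1) ∧ (D4) ∧ CAP+tail; G-an2-4 gates asym, D1 and NE2/3/4.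
-/

noncomputable section

namespace Summit.QuantumFields.BalabanUV.T4Continuum.VariationalColourOneStepPhys

open Finset
open Literature.MathematicalPhysics.QuantumFieldTheory.Balaban1983to89
open Literature.MathematicalPhysics.QuantumFieldTheory.Balaban1983to89.B5Prop11Plancherel (Tor fine unitVec)
open Literature.MathematicalPhysics.QuantumFieldTheory.Balaban1983to89.B5Block118 (bpt)
open Summit.QuantumFields.BalabanUV.T4Continuum.VariationalTransfer (blockSpin blockSpin_le)
open Summit.QuantumFields.BalabanUV.T4Continuum.VariationalColourFederbush (cDv dirUv Qcv dirUv_nonneg)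
open Summit.QuantumFields.BalabanUV.T4Continuum.VariationalColourInterpolant (interpv hessv hessv_nonneg Qcv_interpv)
open Summit.QuantumFields.BalabanUV.T4Continuum.VariationalColourOneStep (sum_dirUv_interpv_le)
open Summit.QuantumFields.BalabanUV.T4Continuum.VariationalCovariantOneStepPhys (scale_sq_sqrt_add)
open Summit.QuantumFields.BalabanUV.T4Continuum.VariationalColourUpperBound (nsqv nsqv_nonneg)
open Summit.QuantumFields.BalabanUV.T4Continuum.VariationalColourScalarPair (Scv Sfv qWv qVv Qkv Q1v Scv_nonneg Sfv_nonneg qWv_nonneg)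

variable {d : ℕ} {E : Type*} [NormedAddCommGroup E] [InnerProductSpace ℂ E] [CompleteSpace E]
variable (n L : ℕ) [NeZero n] [NeZero L] (M : Fin d → ℕ) [hM : ∀ μ, NeZero (M μ)]

/-! ## §1 The regularity functional in physical units (the colour letters `Scv ∕ Sfv ∕ qWv ∕ Q1v` are `VariationalColourScalarPair`'s) -/

/-- the regularity functional of leaf ONE⁺ in physical units at level `n`: `ρ(f) = n⁴∕n^d · hessv f`. [folklore] -/
def rhov (Rc : Tor (fine n M) → Fin d → (E →L[ℂ] E)) (f : Tor (fine n M) → E) : ℝ := (n : ℝ) ^ 4 / (n : ℝ) ^ d * hessv (fine n M) Rc f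

omit [CompleteSpace E] in
/-- `ρ ≥ 0`. [folklore] -/
theorem rhov_nonneg (Rc : Tor (fine n M) → Fin d → (E →L[ℂ] E)) (f : Tor (fine n M) → E) : 0 ≤ rhov n M Rc f :=
  mul_nonneg (by positivity) (hessv_nonneg _ _ _)

/-! ## §2 The one-step END in physical units and its block-spin reading -/

/-- **LEAF V-COL-ONE (physical units)**: the fine colour covariant Dirichlet FORM of the competitor against the coarse form, the regularity functional
`ρ` and the `L²` size of the coarse field:
`Sfv(Λ′) ≤ ( √( Scv λ + (d∕4 + 1∕2)·(L∕n²)·ρ λ ) + √(2d(1+d²))·(n·L·m)·√(qWv λ) )²`. [folklore] -/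
theorem Sfv_interpv_le {Rc : Tor (fine n M) → Fin d → (E →L[ℂ] E)} {R' : Tor (fine L (fine n M)) → Fin d → (E →L[ℂ] E)}
    {T' : Tor (fine L (fine n M)) → (E →L[ℂ] E)} (hT1 : ∀ x, T' x ∈ unitary (E →L[ℂ] E)) (hRc1 : ∀ y μ, Rc y μ ∈ unitary (E →L[ℂ] E))
    {m : ℝ} (hm : 0 ≤ m)
    (hin : ∀ (y : Tor (fine n M)) (j : Fin d → Fin L) (μ : Fin d), (j μ : ℕ) + 1 < L →
      ‖R' (bpt L (fine n M) y j) μ * star (T' (bpt L (fine n M) y j + unitVec (fine L (fine n M)) μ)) - star (T' (bpt L (fine n M) y j))‖ ≤ m)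
    (hcross : ∀ (y : Tor (fine n M)) (j : Fin d → Fin L) (μ : Fin d), (j μ : ℕ) + 1 = L →
      ‖R' (bpt L (fine n M) y j) μ * star (T' (bpt L (fine n M) y j + unitVec (fine L (fine n M)) μ))
        - star (T' (bpt L (fine n M) y j)) * Rc y μ‖ ≤ m)
    (lam : Tor (fine n M) → E) :
    Sfv n L M R' (interpv L (fine n M) T' Rc lam)
      ≤ (Real.sqrt (Scv n M Rc lam + ((d : ℝ) / 4 + 1 / 2) * ((L : ℝ) / (n : ℝ) ^ 2) * rhov n M Rc lam)
          + Real.sqrt (2 * d * (1 + (d : ℝ) ^ 2)) * ((n : ℝ) * L * m) * Real.sqrt (qWv n M lam)) ^ 2 := by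
  have hn : (0 : ℝ) < n := by exact_mod_cast Nat.pos_of_ne_zero (NeZero.ne n)
  have hL : (0 : ℝ) < L := by exact_mod_cast Nat.pos_of_ne_zero (NeZero.ne L)
  have hnd : (0 : ℝ) < (n : ℝ) ^ d := pow_pos hn d
  have hLd : (0 : ℝ) < (L : ℝ) ^ d := pow_pos hL d
  have hnLd : (0 : ℝ) < ((n : ℝ) * L) ^ d := pow_pos (mul_pos hn hL) d
  have hs0 : 0 ≤ ((n : ℝ) * L) ^ 2 / ((n : ℝ) * L) ^ d := by positivity
  have hX0 : 0 ≤ ∑ μ, dirUv (fine n M) Rc lam μ := Finset.sum_nonneg fun μ _ => dirUv_nonneg _ _ _ _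
  have hH0 : 0 ≤ hessv (fine n M) Rc lam := hessv_nonneg _ _ _
  have hY0 : 0 ≤ ∑ y, ‖lam y‖ ^ 2 := sum_nonneg fun _ _ => sq_nonneg _
  have hlat := sum_dirUv_interpv_le L (fine n M) (Rc := Rc) (lam := lam) hT1 hRc1 hm hin hcross
  have hSf : Sfv n L M R' (interpv L (fine n M) T' Rc lam)
      = ((n : ℝ) * L) ^ 2 / ((n : ℝ) * L) ^ d * ∑ μ, dirUv (fine L (fine n M)) R' (interpv L (fine n M) T' Rc lam) μ := rfl
  have hsP : ((n : ℝ) * L) ^ 2 / ((n : ℝ) * L) ^ d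
        * ((L : ℝ) ^ d / (L : ℝ) ^ 2 * (∑ μ, dirUv (fine n M) Rc lam μ) + ((d : ℝ) / 4 + 1 / 2) * ((L : ℝ) ^ d / L) * hessv (fine n M) Rc lam)
      = Scv n M Rc lam + ((d : ℝ) / 4 + 1 / 2) * ((L : ℝ) / (n : ℝ) ^ 2) * rhov n M Rc lam := by
    have hSc : Scv n M Rc lam = (n : ℝ) ^ 2 / (n : ℝ) ^ d * ∑ μ, dirUv (fine n M) Rc lam μ := rfl
    have hrho : rhov n M Rc lam = (n : ℝ) ^ 4 / (n : ℝ) ^ d * hessv (fine n M) Rc lam := rfl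
    rw [hSc, hrho, mul_pow]
    field_simp
    ring
  have hsQ : Real.sqrt (((n : ℝ) * L) ^ 2 / ((n : ℝ) * L) ^ d)
        * (Real.sqrt d * (m * Real.sqrt (2 * (1 + (d : ℝ) ^ 2) * ((L : ℝ) ^ d * ∑ y, ‖lam y‖ ^ 2))))
      = Real.sqrt (2 * d * (1 + (d : ℝ) ^ 2)) * ((n : ℝ) * L * m) * Real.sqrt (qWv n M lam) := by
    have hqW : qWv n M lam = ((n : ℝ) ^ d)⁻¹ * ∑ y, ‖lam y‖ ^ 2 := rfl
    have e1 : ((n : ℝ) * L) ^ 2 / ((n : ℝ) * L) ^ d * ((L : ℝ) ^ d * ∑ y, ‖lam y‖ ^ 2) = ((n : ℝ) * L) ^ 2 * qWv n M lam := by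
      rw [hqW]; field_simp; ring
    have e2 : Real.sqrt (((n : ℝ) * L) ^ 2 / ((n : ℝ) * L) ^ d) * Real.sqrt ((L : ℝ) ^ d * ∑ y, ‖lam y‖ ^ 2)
        = (n : ℝ) * L * Real.sqrt (qWv n M lam) := by
      rw [← Real.sqrt_mul hs0, e1, Real.sqrt_mul (sq_nonneg _), Real.sqrt_sq (by positivity)]
    have e3 : Real.sqrt (2 * (1 + (d : ℝ) ^ 2) * ((L : ℝ) ^ d * ∑ y, ‖lam y‖ ^ 2))
        = Real.sqrt (2 * (1 + (d : ℝ) ^ 2)) * Real.sqrt ((L : ℝ) ^ d * ∑ y, ‖lam y‖ ^ 2) := Real.sqrt_mul (by positivity) _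
    have e4 : Real.sqrt (2 * d * (1 + (d : ℝ) ^ 2)) = Real.sqrt d * Real.sqrt (2 * (1 + (d : ℝ) ^ 2)) := by
      rw [← Real.sqrt_mul (Nat.cast_nonneg d)]; congr 1; ring
    rw [e3, e4]
    calc Real.sqrt (((n : ℝ) * L) ^ 2 / ((n : ℝ) * L) ^ d)
          * (Real.sqrt d * (m * (Real.sqrt (2 * (1 + (d : ℝ) ^ 2)) * Real.sqrt ((L : ℝ) ^ d * ∑ y, ‖lam y‖ ^ 2))))
        = Real.sqrt d * Real.sqrt (2 * (1 + (d : ℝ) ^ 2)) * m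
            * (Real.sqrt (((n : ℝ) * L) ^ 2 / ((n : ℝ) * L) ^ d) * Real.sqrt ((L : ℝ) ^ d * ∑ y, ‖lam y‖ ^ 2)) := by ring
      _ = _ := by rw [e2]; ring
  rw [hSf]
  refine (mul_le_mul_of_nonneg_left hlat hs0).trans (le_of_eq ?_)
  rw [scale_sq_sqrt_add hs0, hsP, hsQ]

/-- **LEAF V-COL-ONE — THE BLOCK-SPIN READING**: the one-step effective action of the fine colour form at the coarse field `λ`,
`T_{Q₁} Sfv (λ) = inf {Sfv f′ : Q_{T′} f′ = λ}`, is at most `( √( Scv λ + (d∕4 + 1∕2)·(L∕n²)·ρ λ ) + √(2d(1+d²))·(n·L·m)·√(qWv λ) )²`.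
Unitary site ∕ coarse operators; every torus, every level; NO `k`, NO NE3. [folklore] -/
theorem blockSpin_Q1v_le {Rc : Tor (fine n M) → Fin d → (E →L[ℂ] E)} {R' : Tor (fine L (fine n M)) → Fin d → (E →L[ℂ] E)}
    {T' : Tor (fine L (fine n M)) → (E →L[ℂ] E)} (hT1 : ∀ x, T' x ∈ unitary (E →L[ℂ] E)) (hRc1 : ∀ y μ, Rc y μ ∈ unitary (E →L[ℂ] E))
    {m : ℝ} (hm : 0 ≤ m)
    (hin : ∀ (y : Tor (fine n M)) (j : Fin d → Fin L) (μ : Fin d), (j μ : ℕ) + 1 < L →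
      ‖R' (bpt L (fine n M) y j) μ * star (T' (bpt L (fine n M) y j + unitVec (fine L (fine n M)) μ)) - star (T' (bpt L (fine n M) y j))‖ ≤ m)
    (hcross : ∀ (y : Tor (fine n M)) (j : Fin d → Fin L) (μ : Fin d), (j μ : ℕ) + 1 = L →
      ‖R' (bpt L (fine n M) y j) μ * star (T' (bpt L (fine n M) y j + unitVec (fine L (fine n M)) μ))
        - star (T' (bpt L (fine n M) y j)) * Rc y μ‖ ≤ m)
    (lam : Tor (fine n M) → E) :
    blockSpin (Q1v n L M T') (Sfv n L M R') lam
      ≤ (Real.sqrt (Scv n M Rc lam + ((d : ℝ) / 4 + 1 / 2) * ((L : ℝ) / (n : ℝ) ^ 2) * rhov n M Rc lam)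
          + Real.sqrt (2 * d * (1 + (d : ℝ) ^ 2)) * ((n : ℝ) * L * m) * Real.sqrt (qWv n M lam)) ^ 2 := by
  have hQ : Q1v n L M T' (interpv L (fine n M) T' Rc lam) = lam := Qcv_interpv L (fine n M) Rc lam hT1
  exact (blockSpin_le (Sfv_nonneg n L M R') hQ).trans (Sfv_interpv_le n L M hT1 hRc1 hm hin hcross lam)

/-- **LEAF V-COL-ONE, `∃`-form in the colour letters**: `∃ f′, Q1v f′ = λ ∧ Sfv f′ ≤ (…)²` (the competitor exhibited). [folklore] -/
theorem exists_oneStep_colour {Rc : Tor (fine n M) → Fin d → (E →L[ℂ] E)} {R' : Tor (fine L (fine n M)) → Fin d → (E →L[ℂ] E)}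
    {T' : Tor (fine L (fine n M)) → (E →L[ℂ] E)} (hT1 : ∀ x, T' x ∈ unitary (E →L[ℂ] E)) (hRc1 : ∀ y μ, Rc y μ ∈ unitary (E →L[ℂ] E))
    {m : ℝ} (hm : 0 ≤ m)
    (hin : ∀ (y : Tor (fine n M)) (j : Fin d → Fin L) (μ : Fin d), (j μ : ℕ) + 1 < L →
      ‖R' (bpt L (fine n M) y j) μ * star (T' (bpt L (fine n M) y j + unitVec (fine L (fine n M)) μ)) - star (T' (bpt L (fine n M) y j))‖ ≤ m)
    (hcross : ∀ (y : Tor (fine n M)) (j : Fin d → Fin L) (μ : Fin d), (j μ : ℕ) + 1 = L →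
      ‖R' (bpt L (fine n M) y j) μ * star (T' (bpt L (fine n M) y j + unitVec (fine L (fine n M)) μ))
        - star (T' (bpt L (fine n M) y j)) * Rc y μ‖ ≤ m)
    (lam : Tor (fine n M) → E) :
    ∃ f' : Tor (fine L (fine n M)) → E, Q1v n L M T' f' = lam ∧
      Sfv n L M R' f' ≤ (Real.sqrt (Scv n M Rc lam + ((d : ℝ) / 4 + 1 / 2) * ((L : ℝ) / (n : ℝ) ^ 2) * rhov n M Rc lam)
          + Real.sqrt (2 * d * (1 + (d : ℝ) ^ 2)) * ((n : ℝ) * L * m) * Real.sqrt (qWv n M lam)) ^ 2 :=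
  ⟨interpv L (fine n M) T' Rc lam, Qcv_interpv L (fine n M) Rc lam hT1, Sfv_interpv_le n L M hT1 hRc1 hm hin hcross lam⟩

/-- **LEAF V-COL-ONE FOR TRANSPORT-FLAT ONE-STEP DATA (`m = 0`) — PURELY ADDITIVE**:
`T_{Q₁} Sfv (λ) ≤ Scv λ + (d∕4 + 1∕2)·(L∕n²)·ρ λ + 0·qWv λ` — the shape of the capstone binder `hONE` with `ε₁ = (d∕4 + 1∕2)·L·n⁻²`, `ε₂ = 0`.
[folklore] -/
theorem blockSpin_Q1v_le_flat {Rc : Tor (fine n M) → Fin d → (E →L[ℂ] E)} {R' : Tor (fine L (fine n M)) → Fin d → (E →L[ℂ] E)}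
    {T' : Tor (fine L (fine n M)) → (E →L[ℂ] E)} (hT1 : ∀ x, T' x ∈ unitary (E →L[ℂ] E)) (hRc1 : ∀ y μ, Rc y μ ∈ unitary (E →L[ℂ] E))
    (hin : ∀ (y : Tor (fine n M)) (j : Fin d → Fin L) (μ : Fin d), (j μ : ℕ) + 1 < L →
      R' (bpt L (fine n M) y j) μ * star (T' (bpt L (fine n M) y j + unitVec (fine L (fine n M)) μ)) = star (T' (bpt L (fine n M) y j)))
    (hcross : ∀ (y : Tor (fine n M)) (j : Fin d → Fin L) (μ : Fin d), (j μ : ℕ) + 1 = L →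
      R' (bpt L (fine n M) y j) μ * star (T' (bpt L (fine n M) y j + unitVec (fine L (fine n M)) μ))
        = star (T' (bpt L (fine n M) y j)) * Rc y μ)
    (lam : Tor (fine n M) → E) :
    blockSpin (Q1v n L M T') (Sfv n L M R') lam
      ≤ Scv n M Rc lam + ((d : ℝ) / 4 + 1 / 2) * ((L : ℝ) / (n : ℝ) ^ 2) * rhov n M Rc lam + 0 * qWv n M lam := by
  have hin' : ∀ (y : Tor (fine n M)) (j : Fin d → Fin L) (μ : Fin d), (j μ : ℕ) + 1 < L →
      ‖R' (bpt L (fine n M) y j) μ * star (T' (bpt L (fine n M) y j + unitVec (fine L (fine n M)) μ)) - star (T' (bpt L (fine n M) y j))‖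
        ≤ 0 :=
    fun y j μ h => by rw [hin y j μ h, sub_self, norm_zero]
  have hcross' : ∀ (y : Tor (fine n M)) (j : Fin d → Fin L) (μ : Fin d), (j μ : ℕ) + 1 = L →
      ‖R' (bpt L (fine n M) y j) μ * star (T' (bpt L (fine n M) y j + unitVec (fine L (fine n M)) μ))
        - star (T' (bpt L (fine n M) y j)) * Rc y μ‖ ≤ 0 :=
    fun y j μ h => by rw [hcross y j μ h, sub_self, norm_zero]
  have h := blockSpin_Q1v_le n L M hT1 hRc1 le_rfl hin' hcross' lam
  have hP : 0 ≤ Scv n M Rc lam + ((d : ℝ) / 4 + 1 / 2) * ((L : ℝ) / (n : ℝ) ^ 2) * rhov n M Rc lam := by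
    have := Scv_nonneg n M Rc lam; have := rhov_nonneg n M Rc lam; positivity
  rw [mul_zero, mul_zero, zero_mul, add_zero, Real.sq_sqrt hP] at h
  rw [zero_mul, add_zero]
  exact h

end Summit.QuantumFields.BalabanUV.T4Continuum.VariationalColourOneStepPhys

end
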